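import Summits.Ventures.PercRepro.S1FiveCircuitX2B

/-!
# PercRepro — LEMMA X⁺, part 3: the dependent `4`-sets and the assembly,
`20·s₅ + 6·C(n−3,2)·s₃ + 16·s₄ + 16(n−3)·s₃ ≤ 24·C(n,4)` under (C1), (C2), (C3) (p2, gen 18)

The dependent `4`-sets include the `s₄` four-circuits and the `(n − 3)·s₃` four-sets containing a triangle (a `4`-set
contains at most one triangle, a four-circuit none). With the charge of part 1 and the count of part 2:
`5·s₅ + (3/2)·s₃·C(n−3,2) + 4·(s₄ + (n−3)·s₃) ≤ 6·C(n,4)` — LEMMA X⁺. In the cells it is consumed as a curve in the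
actual `s₃` (and `s₄`): with LEMMAS V and W′ it closes `(7, 36)`, `(7, 37)`, `(8, 21)` and, with LEMMA Q‴'s cap, `(9, 15)`.

* `card_add_mul_card_le_sum_dep` — `s₄ + (n−3)·s₃ ≤ #{dependent 4-sets}`;
* **`twenty_mul_ncard_fiveCircuits_add_le`** — LEMMA X⁺; **`core_twenty_mul_ncard_fiveCircuits_add_le`** — on the core.
Axioms: standard.
-/

open scoped Matroid

namespace PercRepro

namespace S1

open Set

variable {α : Type}

open Classical in
/-- **The dependent `4`-sets, counted**: `s₄ + (n − 3)·s₃ ≤ #{Q ⊆ E : |Q| = 4, Q dependent}` (under (C1)): the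
four-circuits, and the `4`-sets containing a triangle (each triangle in `n − 3` of them, a `4`-set containing at
most one triangle), are dependent, and the two families are disjoint. -/
theorem card_add_mul_card_le_sum_dep (M : Matroid α) [M.Finite]
    (hC1 : ∀ L ⊆ M.E, M.eRk L = 2 → L.ncard ≤ 3) :
    (finite_fourCircuits M).toFinset.card + (M.E.ncard - 3) * (finite_triangles M).toFinset.card ≤
      ∑ Q ∈ M.ground_finite.toFinset.powersetCard 4, (if M.Indep ((Q : Finset α) : Set α) then 0 else 1) := by
  classical
  set Ef := M.ground_finite.toFinset with hEf
  have hmemE : ∀ x, x ∈ Ef ↔ x ∈ M.E := fun x => Set.Finite.mem_toFinset _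
  have hEcard : Ef.card = M.E.ncard := (Set.ncard_eq_toFinset_card _ _).symm
  set F3 := (finite_triangles M).toFinset with hF3
  set F4 := (finite_fourCircuits M).toFinset with hF4
  set Tf : Set α → Finset α := fun T => Ef.filter (fun x => x ∈ T) with hTf
  have hTfcoe : ∀ T, T ⊆ M.E → ((Tf T : Finset α) : Set α) = T := by
    intro T hT
    ext x
    simp only [hTf, Finset.coe_filter, Set.mem_setOf_eq, hmemE]
    exact ⟨fun h => h.2, fun h => ⟨hT h, h⟩⟩
  have hTfsub : ∀ T, Tf T ⊆ Ef := fun T => Finset.filter_subset _ _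
  -- the right-hand side is the number of dependent `4`-sets
  rw [show ∑ Q ∈ Ef.powersetCard 4, (if M.Indep ((Q : Finset α) : Set α) then 0 else 1) =
      ((Ef.powersetCard 4).filter (fun Q => ¬ M.Indep ((Q : Finset α) : Set α))).card by
    rw [Finset.card_filter]
    apply Finset.sum_congr rfl
    intro Q _
    rw [ite_not]]
  -- the four-circuits
  set A : Finset (Finset α) := F4.image Tf with hA
  have hAcard : A.card = F4.card := by
    rw [hA]
    apply Finset.card_image_of_injOn
    intro C hC C' hC' hCC'
    rw [Finset.mem_coe, hF4, Set.Finite.mem_toFinset] at hC hC'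
    have h1 := hTfcoe C hC.1.subset_ground
    have h2 := hTfcoe C' hC'.1.subset_ground
    rw [← h1, ← h2, hCC']
  -- the `4`-sets containing a triangle
  set B : Finset (Finset α) := (F3.sigma (fun T => Ef \ Tf T)).image (fun x => insert x.2 (Tf x.1)) with hB
  have hBterm : ∀ T ∈ F3, (Ef \ Tf T).card = M.E.ncard - 3 := by
    intro T hT
    rw [hF3, Set.Finite.mem_toFinset] at hT
    have h := Finset.card_sdiff_add_card_eq_card (hTfsub T)
    have h3 : (Tf T).card = 3 := by rw [← Set.ncard_coe_finset, hTfcoe T hT.1.subset_ground, hT.2]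
    rw [h3, hEcard] at h
    omega
  have hBcard : B.card = (M.E.ncard - 3) * F3.card := by
    rw [hB, Finset.card_image_of_injOn, Finset.card_sigma]
    · rw [Finset.sum_congr rfl hBterm, Finset.sum_const, smul_eq_mul, mul_comm]
    · intro x hx y hy hxy
      rw [Finset.mem_coe, Finset.mem_sigma, Finset.mem_sdiff] at hx hy
      obtain ⟨hTx, hxE, hxT⟩ := hx
      obtain ⟨hTy, hyE, hyT⟩ := hy
      rw [hF3, Set.Finite.mem_toFinset] at hTx hTy
      simp only at hxy
      -- the triangles coincide: both lie in the `4`-set, and a `4`-set holds at most one triangle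
      have hsubx : x.1 ⊆ (↑(insert x.2 (Tf x.1)) : Set α) := by
        rw [Finset.coe_insert, hTfcoe _ hTx.1.subset_ground]
        exact Set.subset_insert _ _
      have hsuby : y.1 ⊆ (↑(insert y.2 (Tf y.1)) : Set α) := by
        rw [Finset.coe_insert, hTfcoe _ hTy.1.subset_ground]
        exact Set.subset_insert _ _
      rw [← hxy] at hsuby
      have hQcard : (↑(insert x.2 (Tf x.1)) : Set α).ncard = 4 := by
        rw [Set.ncard_coe_finset, Finset.card_insert_of_notMem (by
          simp only [hTf, Finset.mem_filter, not_and]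
          intro _ h
          exact hxT (by simp only [hTf, Finset.mem_filter]; exact ⟨hxE, h⟩)),
          ← Set.ncard_coe_finset, hTfcoe _ hTx.1.subset_ground, hTx.2]
      have hTT : x.1 = y.1 := by
        by_contra hne
        -- two distinct triangles in a `4`-set: they meet in `≤ 1` point, so the union has `≥ 5` points
        have hxfin : x.1.Finite := M.ground_finite.subset hTx.1.subset_ground
        have hyfin : y.1.Finite := M.ground_finite.subset hTy.1.subset_ground
        have hint : (x.1 ∩ y.1).ncard ≤ 1 := by
          by_contra hlt
          push Not at hlt
          obtain ⟨a, ha, b, hb, hab⟩ := (Set.one_lt_ncard (hxfin.subset Set.inter_subset_left)).1 hlt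
          have hx' : x.1 ∈ ThmN.trianglesThrough M a := ⟨hTx.1, hTx.2, ha.1⟩
          have hy' : y.1 ∈ ThmN.trianglesThrough M a := ⟨hTy.1, hTy.2, ha.2⟩
          exact hne (eq_of_mem_trianglesThrough_of_mem M hC1 hx' hy' hb.1 hb.2 hab.symm)
        have hunion := Set.ncard_union_add_ncard_inter x.1 y.1 hxfin hyfin
        have hle := Set.ncard_le_ncard (Set.union_subset hsubx hsuby) (Finset.finite_toSet _)
        rw [hQcard] at hle
        rw [hTx.2, hTy.2] at hunion
        omega
      -- then the extra points coincide
      have hxQ : x.2 ∈ insert y.2 (Tf y.1) := by rw [← hxy]; exact Finset.mem_insert_self _ _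
      rw [Finset.mem_insert] at hxQ
      rcases hxQ with h | h
      · obtain ⟨Tx, ex⟩ := x
        obtain ⟨Ty, ey⟩ := y
        simp only at hTT h
        subst hTT
        subst h
        rfl
      · exfalso
        rw [← hTT] at h
        exact hxT h
  -- `A` and `B` are disjoint: a four-circuit contains no triangle
  have hAB : Disjoint A B := by
    rw [Finset.disjoint_left]
    intro Q hQA hQB
    rw [hA, Finset.mem_image] at hQA
    rw [hB, Finset.mem_image] at hQB
    obtain ⟨C, hC, rfl⟩ := hQA
    obtain ⟨x, hx, hxQ⟩ := hQB
    rw [hF4, Set.Finite.mem_toFinset] at hC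
    rw [Finset.mem_sigma, Finset.mem_sdiff] at hx
    obtain ⟨hT, -, -⟩ := hx
    rw [hF3, Set.Finite.mem_toFinset] at hT
    have hTC : x.1 ⊆ C := by
      have h := congrArg (fun s : Finset α => (↑s : Set α)) hxQ
      rw [Finset.coe_insert, hTfcoe _ hT.1.subset_ground, hTfcoe _ hC.1.subset_ground] at h
      rw [← h]
      exact Set.subset_insert _ _
    have hTC' : x.1 ⊂ C := hTC.ssubset_of_ne (by
      intro h
      have h3 := hT.2
      rw [h, hC.2] at h3
      omega)
    exact hT.1.dep.not_indep (hC.1.ssubset_indep hTC')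
  -- both lie among the dependent `4`-sets
  have hsub : A ∪ B ⊆ (Ef.powersetCard 4).filter (fun Q => ¬ M.Indep ((Q : Finset α) : Set α)) := by
    intro Q hQ
    rw [Finset.mem_union] at hQ
    rw [Finset.mem_filter, Finset.mem_powersetCard]
    rcases hQ with hQ | hQ
    · rw [hA, Finset.mem_image] at hQ
      obtain ⟨C, hC, rfl⟩ := hQ
      rw [hF4, Set.Finite.mem_toFinset] at hC
      have hcoe := hTfcoe C hC.1.subset_ground
      refine ⟨⟨hTfsub C, ?_⟩, ?_⟩
      · rw [← Set.ncard_coe_finset, hcoe, hC.2]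
      · rw [hcoe]
        exact hC.1.dep.not_indep
    · rw [hB, Finset.mem_image] at hQ
      obtain ⟨x, hx, rfl⟩ := hQ
      rw [Finset.mem_sigma, Finset.mem_sdiff] at hx
      obtain ⟨hT, hxE, hxT⟩ := hx
      rw [hF3, Set.Finite.mem_toFinset] at hT
      have hcoe := hTfcoe _ hT.1.subset_ground
      have hnot : x.2 ∉ Tf x.1 := hxT
      refine ⟨⟨Finset.insert_subset hxE (hTfsub _), ?_⟩, ?_⟩
      · rw [Finset.card_insert_of_notMem hnot, ← Set.ncard_coe_finset, hcoe, hT.2]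
      · rw [Finset.coe_insert, hcoe]
        have hDep : M.Dep (insert x.2 x.1) :=
          hT.1.dep.superset (Set.subset_insert _ _) (Set.insert_subset ((hmemE _).1 hxE) hT.1.subset_ground)
        exact hDep.not_indep
  calc F4.card + (M.E.ncard - 3) * F3.card = A.card + B.card := by rw [hAcard, hBcard]
    _ = (A ∪ B).card := (Finset.card_union_eq_card_add_card.2 hAB).symm
    _ ≤ _ := Finset.card_le_card hsub

/-- **LEMMA X⁺**: under (C1), (C2), (C3),
`20·s₅ + 6·s₃·C(n−3, 2) + 16·s₄ + 16·(n−3)·s₃ ≤ 24·C(n, 4)`. -/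
theorem twenty_mul_ncard_fiveCircuits_add_le (M : Matroid α) [M.Finite]
    (hC1 : ∀ L ⊆ M.E, M.eRk L = 2 → L.ncard ≤ 3) (hC2 : ∀ P ⊆ M.E, M.eRk P ≤ 3 → P.ncard ≤ 6)
    (hC3 : ∀ X ⊆ M.E, M.eRk X ≤ 4 → X.ncard ≤ 10) :
    20 * (fiveCircuits M).ncard + 6 * (ThmN.triangles M).ncard * (M.E.ncard - 3).choose 2 +
        16 * (fourCircuits M).ncard + 16 * (M.E.ncard - 3) * (ThmN.triangles M).ncard ≤
      24 * M.E.ncard.choose 4 := by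
  classical
  have hEcard : M.ground_finite.toFinset.card = M.E.ncard := (Set.ncard_eq_toFinset_card _ _).symm
  have hF5 : (fiveCircuits M).ncard = (finite_fiveCircuits M).toFinset.card := Set.ncard_eq_toFinset_card _ _
  have hF4 : (fourCircuits M).ncard = (finite_fourCircuits M).toFinset.card := Set.ncard_eq_toFinset_card _ _
  have hF3 : (ThmN.triangles M).ncard = (finite_triangles M).toFinset.card := Set.ncard_eq_toFinset_card _ _
  have hsum : ∑ Q ∈ M.ground_finite.toFinset.powersetCard 4,
      ((fifth M Q).card + (excl M Q).card + 4 * (if M.Indep ((Q : Finset α) : Set α) then 0 else 1)) ≤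
      ∑ _Q ∈ M.ground_finite.toFinset.powersetCard 4, 6 :=
    Finset.sum_le_sum (fun Q hQ => card_fifth_add_card_excl_le M hC2 hC3 hQ)
  rw [Finset.sum_add_distrib, Finset.sum_add_distrib, sum_card_fifth, ← Finset.mul_sum, Finset.sum_const,
    smul_eq_mul, Finset.card_powersetCard, hEcard] at hsum
  have h3 := three_mul_card_mul_choose_le_two_mul_sum_card_excl M hC1
  have h4 := card_add_mul_card_le_sum_dep M hC1
  rw [hF5, hF4, hF3]
  nlinarith [hsum, h3, h4]

/-- **LEMMA X⁺ on the `e`-free core**, in the set-builder vocabulary of `S1RowTwelve`. -/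
theorem core_twenty_mul_ncard_fiveCircuits_add_le (M : Matroid α) [M.Finite]
    (hfree : ∀ e ∈ M.E, ∃ A ⊆ M.E \ {e}, e ∉ M.closure A ∧ e ∉ M.closure ((M.E \ {e}) \ A)) :
    20 * {C : Set α | M.IsCircuit C ∧ C.ncard = 5}.ncard +
        6 * {C : Set α | M.IsCircuit C ∧ C.ncard = 3}.ncard * (M.E.ncard - 3).choose 2 +
        16 * {C : Set α | M.IsCircuit C ∧ C.ncard = 4}.ncard +
        16 * (M.E.ncard - 3) * {C : Set α | M.IsCircuit C ∧ C.ncard = 3}.ncard ≤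
      24 * M.E.ncard.choose 4 := by
  have hL : ∀ e ∈ M.E, ¬ M.IsLoop e := ThmN.not_isLoop_of_free M hfree
  have hline : ∀ L ⊆ M.E, M.eRk L = 2 → L.ncard ≤ 3 := by
    intro L hL' hr
    have := ThmN.ncard_add_one_le_two_pow_of_eRk_le M hL hfree 2 L hL' hr.le
    omega
  have hplane : ∀ P ⊆ M.E, M.eRk P ≤ 3 → P.ncard ≤ 6 := fun P hP hr =>
    ThmN.ncard_le_six_of_eRk_le_three_of_free M hfree hP hr
  have hten : ∀ X ⊆ M.E, M.eRk X ≤ 4 → X.ncard ≤ 10 := fun X hX hr =>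
    ThmN.ncard_le_ten_of_eRk_le_four_of_free M hfree hX hr
  exact twenty_mul_ncard_fiveCircuits_add_le M hline hplane hten

end S1

end PercRepro
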